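import Mathlib
import HarnessLib
import Summits.ResolutionOfSingularities.ResolutionOfSingularities.Theorems.HugValuationCutKernels

/-!
# MarkingBudgetClasses — decomp-res node «MarkingBudget» (lens-4 g15; CRITIC-LEDGER row 101 CLEARED: DECIDED +1
cell (O-arc), MAP +1)
refining the MaxContactCut aside 32260 `NoSingularSurfaceHuggingTowers` (host of the lens-4 column).

Content VERBATIM from the decomp-res lens-4 cumulative file `HOME/decomp-res-lens-4/g18/CouplingCut.lean` (sha256
5bf7b2ca8f7311e8;
its §1–§6 = g14 HugValuationCut, ALREADY in the tree as `Theorems/HugValuationCut{Chains,Classes,Kernels}` +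
`MaxContactCutHugValuationCut`; §7–§12 = g15 «MarkingBudget» @369c12ac; §13–§17 = g16 «WeightDescent»
@1cb1c32f; §18–§23 = g17
«FactorContact» @daf245ab; §24–§31 = g18 «CouplingCut»).  HOME = run/shared/lean/pub/decomp-res.

Tree file 1/3 of the node, route-independent and OUTSIDE the Theses cone: §7 marked sequences on a hug chain and
the MARKING BUDGET
LAW (PROVED: `zeno`, `no_gap_of_marked`, `not_isZValued_of_marked`); §8 the LOCUS AXIS (off-locus / in-locus
shadows, `MarkedShadow`,
Zeno normal form `MarkedShadow.no_arc` / `.zeno`); §9 the pieces of the locus axis × the g14 value grid.  File 2/3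
`MarkingBudgetKernels` = §10 marking port + §11 kernels + §12 all-weights classes; file 3/3
`MaxContactCutMarkingBudget` = the §12
BY-NAME wiring.
[WRITER NOTE (decomp-res writer g6): the whole lens-4 chain lives in ONE namespace `…Theorems.HugValuationCut` (the tree's g14
namespace) so that the lens's `HugChain.`/`HugShadow.`/`MarkedShadow.` dot-notation extends the landed structures
verbatim; the lens's
`noTower_iff_perfect_and_imperfect` is the tree's `ContactShadowKernels.noTower_iff_columns`; `set_option` lines
dropped; cone-free
(no `Theses` import) so the route file can import it for asides; the BY-NAME wiring to the MaxContactCut items is in the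
`MaxContactCut<Node>` companion files.]
(Sources: CossartJannsenSaito2020 Thm. 2.14, Key Thm. 6.40, Cor. 6.37; BierstoneGrigorievMilmanWlodarczyk2011 §3;
CossartPiltant2019; Abhyankar1956; Cutkosky2009 §2.1.)
-/

noncomputable section

open CategoryTheory AlgebraicGeometry IsLocalRing
open Literature.AlgebraicGeometry.Resolution
open Summit.ResolutionOfSingularities.ResolutionOfSingularities.Theorems
open WeakOrderReduction ForcedTowerClasses DivergentTowerClasses MonomialTowerClasses
open HugDimensionClasses HugDimensionKernels SurfaceShadowClasses SurfaceShadowKernels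
open ContactShadowClasses (NoTowerImperfect)
open ContactShadowKernels (noTowerImperfect_of_noTower noTowerImperfect_mono noTower_iff_columns)
open NearPointCut (SingularClass singularSurface_iff_noTower)

namespace Summit.ResolutionOfSingularities.ResolutionOfSingularities.Theorems.HugValuationCut

variable {K : Type} [Field K]

/-! ## §7 (g15 · NEW) Marked sequences on a hug chain and the MARKING BUDGET LAW (PROVED)

The FORCING read on the shadow.  Along a forced tower the marked ideal `I_j = 𝓘(D j)` has order exactly `n` at `pt j`
and `I_{j+1}·𝒪_{pt (j+1)} = u^{-n} · I_j·𝒪_{pt (j+1)}` (controlled transform; `u ∈ 𝔪_j` an exceptional equation).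
Restricted to the hugged surface this reads `Ī_{i+1} = z_i^{-n} · Ī_i R_{i+1}` with `z_i = ū` a DIVIDER of the shadow
chain (paper proof (P4)).  So a non-zero element `f_0` of the restricted marking `Ī_0 = I_m|Σ` — it exists iff the
shadow is OFF-LOCUS (§8) — propagates to non-zero `f_i ∈ Ī_i ⊆ R_i`, `f_{i+1} = f_i / z_i^n`: a MARKED SEQUENCE (port
`MarkingPort`).  Against ANY real valuation cutting out a dominating ring this gives the BUDGET
`n · Σ_{i<N} v(z_i) ≤ v(f_0)` (telescoping + `v(f_N) ≥ 0`): the divider values `ρ_i = v(z_i) = min v(𝔪_i ∖ 0)` are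
SUMMABLE with sum `≤ v(f_0)/n` (ZENO, `zeno`), there is no uniform value gap (`no_gap_of_marked`), and a `ℤ`-valued
dominating ring (`ρ_i ≥ 1`) is IMPOSSIBLE (`not_isZValued_of_marked`). -/

namespace HugChain

variable (C : HugChain K)

/-- A DIVIDER SEQUENCE of the chain: `z i` is a non-zero nonunit of `R i` dividing, inside `R (i+1)`, every nonunit
of `R i` (`𝔪_i R_{i+1} = z_i R_{i+1}`: a local equation at `x_{i+1}` of the exceptional curve of the `i`-th point
blow-up of the hugged surface).  Exists by `exists_divider` (`exists_isDividerSeq`). -/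
def IsDividerSeq (z : ℕ → K) : Prop :=
  ∀ i, z i ∈ C.R i ∧ z i ≠ 0 ∧ (z i)⁻¹ ∉ C.R i ∧ ∀ y ∈ C.R i, y⁻¹ ∉ C.R i → y / z i ∈ C.R (i + 1)

/-- A MARKED SEQUENCE of weight `n` over the divider sequence `z`: non-zero `f i ∈ R i` with
`f (i+1) = f i / (z i)^n` — the restricted controlled transforms `f_i ∈ I_{m+i}|Σ_i` of a non-zero element of the
RESTRICTED MARKING of an off-locus shadow (port `MarkingPort`, paper proof (P4)). -/
def IsMarkedSeq (n : ℕ) (z f : ℕ → K) : Prop :=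
  (∀ i, f i ∈ C.R i ∧ f i ≠ 0) ∧ ∀ i, f (i + 1) = f i / z i ^ n

/-- Divider sequences exist (the blow-up relation of each quadratic transform + choice). [folklore] -/
theorem exists_isDividerSeq : ∃ z : ℕ → K, C.IsDividerSeq z := by
  choose z hz using C.exists_divider
  exact ⟨z, hz⟩

/-- `v 1 = 0` for a map additive on products of non-zero elements. [folklore] -/
theorem val_one (v : K → ℝ) (hmul : ∀ x y : K, x ≠ 0 → y ≠ 0 → v (x * y) = v x + v y) : v 1 = 0 := by
  have := hmul 1 1 one_ne_zero one_ne_zero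
  rw [one_mul] at this
  linarith

/-- `v (y^n) = n · v y`. [folklore] -/
theorem val_pow (v : K → ℝ) (hmul : ∀ x y : K, x ≠ 0 → y ≠ 0 → v (x * y) = v x + v y) {y : K} (hy : y ≠ 0)
    (n : ℕ) : v (y ^ n) = n * v y := by
  induction n with
  | zero => simp [val_one v hmul]
  | succ n ih =>
    rw [pow_succ, hmul _ _ (pow_ne_zero n hy) hy, ih]
    push_cast
    ring

/-- `v (x / y^n) = v x - n · v y`. [folklore] -/
theorem val_div_pow (v : K → ℝ) (hmul : ∀ x y : K, x ≠ 0 → y ≠ 0 → v (x * y) = v x + v y) {x y : K}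
    (hx : x ≠ 0) (hy : y ≠ 0) (n : ℕ) : v (x / y ^ n) = v x - n * v y := by
  have hyn : y ^ n ≠ 0 := pow_ne_zero n hy
  have hq : x / y ^ n ≠ 0 := div_ne_zero hx hyn
  have h : v x = v (x / y ^ n) + v (y ^ n) := by rw [← hmul _ _ hq hyn, div_mul_cancel₀ x hyn]
  rw [val_pow v hmul hy] at h
  linarith

/-- **ρ_i IS THE DIVIDER'S VALUE**: under any real valuation cutting out a dominating ring, the divider `z i` has the
least value among the non-zero nonunits of `R i`. [folklore] -/
theorem divider_le {V : ValuationSubring K} (hV : C.DominatedBy V) (v : K → ℝ)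
    (hmul : ∀ x y : K, x ≠ 0 → y ≠ 0 → v (x * y) = v x + v y)
    (hcut : ∀ x : K, x ≠ 0 → (x ∈ V ↔ 0 ≤ v x)) {z : ℕ → K} (hz : C.IsDividerSeq z) (i : ℕ)
    {y : K} (hy : y ∈ C.R i) (hy0 : y ≠ 0) (hyinv : y⁻¹ ∉ C.R i) : v (z i) ≤ v y := by
  obtain ⟨-, hz0, -, hdiv⟩ := hz i
  have hq : y / z i ∈ V := (hV (i + 1)).1 (hdiv y hy hyinv)
  have hq0 : y / z i ≠ 0 := div_ne_zero hy0 hz0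
  have h0 : 0 ≤ v (y / z i) := (hcut _ hq0).mp hq
  have h : v y = v (y / z i) + v (z i) := by rw [← hmul _ _ hq0 hz0, div_mul_cancel₀ y hz0]
  linarith

/-- **TELESCOPE**: `v(f_0) = v(f_N) + n · Σ_{i<N} v(z_i)` along a marked sequence. [folklore] -/
theorem marked_telescope (v : K → ℝ) (hmul : ∀ x y : K, x ≠ 0 → y ≠ 0 → v (x * y) = v x + v y) {n : ℕ}
    {z f : ℕ → K} (hz : ∀ i, z i ≠ 0) (hf : C.IsMarkedSeq n z f) (N : ℕ) :
    v (f 0) = v (f N) + n * ∑ i ∈ Finset.range N, v (z i) := by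
  induction N with
  | zero => simp
  | succ N ih =>
    rw [Finset.sum_range_succ, hf.2 N, val_div_pow v hmul (hf.1 N).2 (hz N) n, mul_add]
    linarith

/-- **THE MARKING BUDGET LAW (PROVED)**: along a marked sequence of weight `n`, for every real valuation cutting out
a dominating ring, `n · Σ_{i<N} v(z_i) ≤ v(f_0)` for all `N` — each forced point blow-up spends `n ρ_i` of the finite
budget `v(f_0)`. [folklore: the valuative transversal-order drop] [folklore] -/
theorem budget_le {V : ValuationSubring K} (hV : C.DominatedBy V) (v : K → ℝ)
    (hmul : ∀ x y : K, x ≠ 0 → y ≠ 0 → v (x * y) = v x + v y)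
    (hcut : ∀ x : K, x ≠ 0 → (x ∈ V ↔ 0 ≤ v x)) {n : ℕ} {z f : ℕ → K} (hz : ∀ i, z i ≠ 0)
    (hf : C.IsMarkedSeq n z f) (N : ℕ) : (n : ℝ) * ∑ i ∈ Finset.range N, v (z i) ≤ v (f 0) := by
  have hN : 0 ≤ v (f N) := (hcut _ (hf.1 N).2).mp ((hV N).1 (hf.1 N).1)
  rw [C.marked_telescope v hmul hz hf N]
  linarith

/-- **ZENO (PROVED)**: for `n ≥ 1` the divider values `ρ_i = v(z_i) ≥ 0` of a chain carrying a marked sequence are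
SUMMABLE, `Σ_i ρ_i ≤ v(f_0)/n`, and tend to `0`. [folklore] -/
theorem zeno {V : ValuationSubring K} (hV : C.DominatedBy V) (v : K → ℝ)
    (hmul : ∀ x y : K, x ≠ 0 → y ≠ 0 → v (x * y) = v x + v y)
    (hcut : ∀ x : K, x ≠ 0 → (x ∈ V ↔ 0 ≤ v x)) {n : ℕ} (hn : 1 ≤ n) {z f : ℕ → K}
    (hz : C.IsDividerSeq z) (hf : C.IsMarkedSeq n z f) :
    Summable (fun i => v (z i)) ∧ ∑' i, v (z i) ≤ v (f 0) / n ∧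
      Filter.Tendsto (fun i => v (z i)) Filter.atTop (nhds 0) := by
  have hz0 : ∀ i, z i ≠ 0 := fun i => (hz i).2.1
  have hnn : ∀ i, 0 ≤ v (z i) := fun i => (hcut _ (hz0 i)).mp ((hV i).1 (hz i).1)
  have hnpos : (0 : ℝ) < n := by exact_mod_cast hn
  have hsum : ∀ N, ∑ i ∈ Finset.range N, v (z i) ≤ v (f 0) / n := by
    intro N
    have hB := C.budget_le hV v hmul hcut hz0 hf N
    rw [le_div_iff₀ hnpos]
    linarith
  have hS : Summable (fun i => v (z i)) := summable_of_sum_range_le hnn hsum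
  exact ⟨hS, Real.tsum_le_of_sum_range_le hnn hsum, hS.tendsto_atTop_zero⟩

/-- **NO VALUE GAP (PROVED)**: a chain carrying a marked sequence of weight `n ≥ 1` has, under every real valuation
cutting out a dominating ring, non-zero nonunits of arbitrarily small value — with NO density hypothesis on the value
group (contrast V4/V5: there the gap was excluded only for dense value groups). [folklore] -/
theorem no_gap_of_marked {V : ValuationSubring K} (hV : C.DominatedBy V) (v : K → ℝ)
    (hmul : ∀ x y : K, x ≠ 0 → y ≠ 0 → v (x * y) = v x + v y)
    (hcut : ∀ x : K, x ≠ 0 → (x ∈ V ↔ 0 ≤ v x)) {n : ℕ} (hn : 1 ≤ n) {z f : ℕ → K}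
    (hz : C.IsDividerSeq z) (hf : C.IsMarkedSeq n z f) :
    ∀ ε : ℝ, 0 < ε → ∃ i, ∃ y ∈ C.R i, y ≠ 0 ∧ y⁻¹ ∉ C.R i ∧ v y < ε := by
  intro ε hε
  obtain ⟨-, -, ht⟩ := C.zeno hV v hmul hcut hn hz hf
  obtain ⟨N, hN⟩ := (Metric.tendsto_atTop.mp ht) ε hε
  refine ⟨N, z N, (hz N).1, (hz N).2.1, (hz N).2.2.1, ?_⟩
  have h := hN N le_rfl
  rw [Real.dist_0_eq_abs, abs_lt] at h
  exact h.2

/-- **THE OFF-LOCUS ARC IS IMPOSSIBLE (PROVED)**: no `ℤ`-valued valuation ring dominates a hug chain that carries a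
marked sequence of weight `n ≥ 1` (each step costs `n · ν(z_i) ≥ n ≥ 1` of the finite budget `ν(f_0)`).  Only the
nonunit property of the `z i` is used. [folklore: Zariski 1940 (discrete rank-one case of local uniformization) /
the transversal-order drop of the tree's `CurveLaw`, read on an arc of the hugged surface] [folklore] -/
theorem not_isZValued_of_marked {V : ValuationSubring K} (hV : C.DominatedBy V) (hZ : IsZValued V) {n : ℕ}
    (hn : 1 ≤ n) {z f : ℕ → K} (hz : ∀ i, z i ∈ C.R i ∧ z i ≠ 0 ∧ (z i)⁻¹ ∉ C.R i)
    (hf : C.IsMarkedSeq n z f) : False := by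
  obtain ⟨ν, hmul, hcut⟩ := hZ
  have h1 : ν 1 = 0 := by
    have := hmul 1 1 one_ne_zero one_ne_zero
    rw [one_mul] at this
    linarith
  -- each `z i` is a nonunit of `R i`, hence of `V` (domination): `ν (z i) ≥ 1`
  have hge : ∀ i, (1 : ℝ) ≤ (ν (z i) : ℝ) := by
    intro i
    obtain ⟨hzi, hz0, hzinv⟩ := hz i
    have hzV : (z i)⁻¹ ∉ V := fun h => hzinv ((hV i).2 (z i) hzi h)
    have hneg : ¬ 0 ≤ ν (z i)⁻¹ := fun h => hzV ((hcut _ (inv_ne_zero hz0)).mpr h)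
    have hsum : ν (z i) + ν (z i)⁻¹ = 0 := by
      rw [← hmul _ _ hz0 (inv_ne_zero hz0), mul_inv_cancel₀ hz0, h1]
    have h1le : (1 : ℤ) ≤ ν (z i) := by omega
    exact_mod_cast h1le
  have hB := C.budget_le hV (fun x => (ν x : ℝ)) (fun x y hx hy => by exact_mod_cast hmul x y hx hy)
    (fun x hx => by rw [hcut x hx]; exact_mod_cast Iff.rfl) (fun i => (hz i).2.1) hf
  obtain ⟨N, hN⟩ := exists_nat_gt ((ν (f 0) : ℝ))
  have hNsum : (N : ℝ) ≤ ∑ i ∈ Finset.range N, (ν (z i) : ℝ) := by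
    have := Finset.sum_le_sum fun i (_ : i ∈ Finset.range N) => hge i
    simpa using this
  have hnonneg : (0 : ℝ) ≤ ∑ i ∈ Finset.range N, (ν (z i) : ℝ) :=
    Finset.sum_nonneg fun i _ => zero_le_one.trans (hge i)
  have hn' : (1 : ℝ) ≤ n := by exact_mod_cast hn
  have hB' : (n : ℝ) * ∑ i ∈ Finset.range N, (ν (z i) : ℝ) ≤ (ν (f 0) : ℝ) := hB N
  nlinarith

end HugChain

/-! ## §8 (g15 · NEW) The locus axis: OFF-LOCUS versus IN-LOCUS shadows; MARKED shadows -/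

namespace HugShadow

variable {T : ForcedTower} (S : HugShadow T)

/-- **OFF-LOCUS shadow**: at the hugging stage the stalk of the MARKED ideal is NOT contained in the stalk of the
ideal of the hugged surface germ — `𝓘(D m)_{pt m} ⊄ 𝓘(Σ)_{pt m}`: the hugged singular surface is NOT inside the zero
locus `V(I_m)`, i.e. the RESTRICTED MARKING `I_m|Σ ⊆ 𝒪_{Σ, pt m}` is a NON-ZERO ideal (`offLocus_iff_map_ne_bot`;
then `I_{m+i}|Σ_i ≠ 0` at every later stage, (P4)).  A predicate of the PINNED data `(m, germ, D m, pt m)` only. -/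
def OffLocus : Prop :=
  ¬ stalkIdeal (T.D S.m).ideal (T.pt S.m) ≤ stalkIdeal S.germ (T.pt S.m)

/-- **IN-LOCUS shadow**: `𝓘(D m)_{pt m} ⊆ 𝓘(Σ)_{pt m}` — the hugged singular surface germ lies INSIDE `V(I_m)` (and
then `Σ_i ⊆ V(I_{m+i})` for ever: total transforms contain controlled transforms). -/
def InLocus : Prop :=
  stalkIdeal (T.D S.m).ideal (T.pt S.m) ≤ stalkIdeal S.germ (T.pt S.m)

/-- pure logic. [folklore] -/
theorem not_offLocus_iff : ¬ S.OffLocus ↔ S.InLocus := not_not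

/-- excluded middle on the locus axis. [folklore] -/
theorem offLocus_or_inLocus : S.OffLocus ∨ S.InLocus := (Classical.em S.InLocus).symm

/-- **OFF-LOCUS = NON-ZERO RESTRICTED MARKING**: the image of `𝓘(D m)_{pt m}` in the local ring
`𝒪_{St m, pt m} ⧸ 𝓘(Σ)_{pt m}` of the hugged surface (≅ `R 0` by the pin) is a non-zero ideal. [folklore] -/
theorem offLocus_iff_map_ne_bot :
    S.OffLocus ↔ (stalkIdeal (T.D S.m).ideal (T.pt S.m)).map
      (Ideal.Quotient.mk (stalkIdeal S.germ (T.pt S.m))) ≠ ⊥ := by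
  rw [OffLocus, Ne, Ideal.map_eq_bot_iff_le_ker, Ideal.mk_ker]

end HugShadow

/-- **MARKED SHADOW of weight `n`** (g15's datum): an OFF-LOCUS hug shadow together with its FORCING DATA read in the
function field of the hugged surface — a divider sequence `z` (exceptional equations) and a marked sequence `f` of
weight `n` over it (`f i ∈ R i` non-zero, `f (i+1) = f i / (z i)^n`: the restricted controlled transforms of a non-zero
element of the restricted marking).  Delivered by the COSTUME port `MarkingPort` from any off-locus shadow (paper proof
(P4)); everything proved about it below is PORT-FREE. -/
structure MarkedShadow (T : ForcedTower) (n : ℕ) : Type 1 where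
  /-- the underlying hug shadow -/
  S : HugShadow T
  /-- it is off-locus -/
  offLocus : S.OffLocus
  /-- the divider sequence (exceptional equations on the hugged surface) -/
  z : ℕ → S.K
  /-- the marked sequence (restricted controlled transforms of a restricted marked function) -/
  f : ℕ → S.K
  /-- `z` is a divider sequence of the shadow chain -/
  divider : S.C.IsDividerSeq z
  /-- `f` is a marked sequence of weight `n` over `z` -/
  marked : S.C.IsMarkedSeq n z f

namespace MarkedShadow

variable {T : ForcedTower} {n : ℕ} (M : MarkedShadow T n)

/-- a marked shadow is an off-locus shadow. [folklore] -/
theorem offLocusShadow (M : MarkedShadow T n) : ∃ S : HugShadow T, S.OffLocus := ⟨M.S, M.offLocus⟩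

/-- **NO ARC (PROVED, port-free)**: for `n ≥ 1` no `ℤ`-valued valuation ring of the function field of the hugged
surface dominates the chain of a marked shadow. [folklore] -/
theorem no_arc (hn : 1 ≤ n) {V : ValuationSubring M.S.K} (hV : M.S.C.DominatedBy V) : ¬ IsZValued V :=
  fun hZ => M.S.C.not_isZValued_of_marked hV hZ hn
    (fun i => ⟨(M.divider i).1, (M.divider i).2.1, (M.divider i).2.2.1⟩) M.marked

/-- **ZENO (PROVED, port-free)**: for `n ≥ 1`, under every real valuation cutting out a dominating ring, the minimal
values `ρ_i = v (z i)` of the maximal ideals of the chain of a marked shadow are summable, `Σ_i ρ_i ≤ v(f_0)/n`, and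
tend to `0`. [folklore] -/
theorem zeno (hn : 1 ≤ n) {V : ValuationSubring M.S.K} (hV : M.S.C.DominatedBy V) (v : M.S.K → ℝ)
    (hmul : ∀ x y : M.S.K, x ≠ 0 → y ≠ 0 → v (x * y) = v x + v y)
    (hcut : ∀ x : M.S.K, x ≠ 0 → (x ∈ V ↔ 0 ≤ v x)) :
    Summable (fun i => v (M.z i)) ∧ ∑' i, v (M.z i) ≤ v (M.f 0) / n ∧
      Filter.Tendsto (fun i => v (M.z i)) Filter.atTop (nhds 0) :=
  M.S.C.zeno hV v hmul hcut hn M.divider M.marked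

/-- `ρ_i = v (z i)` IS the least value of a non-zero nonunit of `R i`. [folklore] -/
theorem rho_le {V : ValuationSubring M.S.K} (hV : M.S.C.DominatedBy V) (v : M.S.K → ℝ)
    (hmul : ∀ x y : M.S.K, x ≠ 0 → y ≠ 0 → v (x * y) = v x + v y)
    (hcut : ∀ x : M.S.K, x ≠ 0 → (x ∈ V ↔ 0 ≤ v x)) (i : ℕ) {y : M.S.K} (hy : y ∈ M.S.C.R i) (hy0 : y ≠ 0)
    (hyinv : y⁻¹ ∉ M.S.C.R i) : v (M.z i) ≤ v y :=
  M.S.C.divider_le hV v hmul hcut M.divider i hy hy0 hyinv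

/-- **NO VALUE GAP (PROVED, port-free)**. [folklore] -/
theorem no_gap (hn : 1 ≤ n) {V : ValuationSubring M.S.K} (hV : M.S.C.DominatedBy V) (v : M.S.K → ℝ)
    (hmul : ∀ x y : M.S.K, x ≠ 0 → y ≠ 0 → v (x * y) = v x + v y)
    (hcut : ∀ x : M.S.K, x ≠ 0 → (x ∈ V ↔ 0 ≤ v x)) :
    ∀ ε : ℝ, 0 < ε → ∃ i, ∃ y ∈ M.S.C.R i, y ≠ 0 ∧ y⁻¹ ∉ M.S.C.R i ∧ v y < ε :=
  M.S.C.no_gap_of_marked hV v hmul hcut hn M.divider M.marked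

/-- a dominating valuation ring of a marked shadow exists (Chevalley, g14 V1). [folklore] -/
theorem exists_dominatedBy : ∃ V : ValuationSubring M.S.K, M.S.C.DominatedBy V := M.S.C.exists_dominatedBy

end MarkedShadow

/-- `T` has an OFF-LOCUS shadow: some hugged integral singular surface read by a shadow is NOT inside `V(I)`. -/
def OffLocusShadow (T : ForcedTower) : Prop := ∃ S : HugShadow T, S.OffLocus

/-- `T` has shadows and ALL of them are IN-LOCUS: every hugged integral surface read by a shadow lies in `V(I)`. -/
def InLocusShadow (T : ForcedTower) : Prop := Nonempty (HugShadow T) ∧ ∀ S : HugShadow T, S.InLocus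

/-- `T` has an OFF-LOCUS ARC of weight `n`: a marked shadow whose chain is dominated by a `ℤ`-valued valuation ring
of the function field of the hugged surface. -/
def OffLocusArc (T : ForcedTower) (n : ℕ) : Prop :=
  ∃ M : MarkedShadow T n, ∃ V : ValuationSubring M.S.K, M.S.C.DominatedBy V ∧ IsZValued V

/-- pure logic. [folklore] -/
theorem not_offLocusShadow_iff {T : ForcedTower} : ¬ OffLocusShadow T ↔ ∀ S : HugShadow T, S.InLocus := by
  simp only [OffLocusShadow, not_exists, HugShadow.not_offLocus_iff]

/-- **NO FORCED TOWER HAS AN OFF-LOCUS ARC of weight `n ≥ 1` (PROVED, port-free)** — the budget law. [folklore] -/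
theorem not_offLocusArc {T : ForcedTower} {n : ℕ} (hn : 1 ≤ n) : ¬ OffLocusArc T n := by
  rintro ⟨M, V, hV, hZ⟩
  exact M.no_arc hn hV hZ

/-- a marked shadow makes the tower off-locus; an off-locus arc makes it a g14-discrete, off-locus tower. [folklore] -/
theorem offLocusShadow_of_marked {T : ForcedTower} {n : ℕ} (M : MarkedShadow T n) : OffLocusShadow T :=
  M.offLocusShadow

/-! ## §9 (g15 · NEW) The pieces of the locus axis (× g14's valuation-type axis on the in-locus column) -/

/-- **PIECE (O-arc) · DECIDED OUTRIGHT for ALL ground fields, PORT-FREE** (`offLocusArc_terminate`, the PROVED budget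
law): singular-class towers with an off-locus arc of weight `n`. -/
def OffLocusArcTowersTerminate (n : ℕ) : Prop :=
  NoTower n fun T => SingularClass T ∧ OffLocusArc T n

/-- **PIECE (O) = THE OFF-LOCUS RESIDUAL · UNDECIDED · INSTRUMENTABLE · normal form ZENO (PROVED, port-free on the
datum)**: singular-class towers with a MARKED shadow of weight `n` (= with an off-locus shadow, modulo `MarkingPort`:
`offLocus_iff_marked`).  Every dominating valuation of a marked shadow is rank-one NON-DISCRETE (`MarkedShadow.no_arc`)
with SUMMABLE gaps `Σ ρ_i ≤ v(f_0)/n` (`MarkedShadow.zeno`). -/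
def OffLocusShadowTowersTerminate (n : ℕ) : Prop :=
  NoTower n fun T => SingularClass T ∧ Nonempty (MarkedShadow T n)

/-- (O) read on the PINNED predicate: singular-class towers with an off-locus shadow. -/
def GeometricOffLocusTowersTerminate (n : ℕ) : Prop :=
  NoTower n fun T => SingularClass T ∧ OffLocusShadow T

/-- **PIECE (L) = THE IN-LOCUS COLUMN · UNDECIDED** (bisected below by g14's valuation type × perfectness):
singular-class towers all of whose shadows are in-locus — the hugged singular surfaces lie INSIDE `V(I)`. -/
def InLocusShadowTowersTerminate (n : ℕ) : Prop :=
  NoTower n fun T => SingularClass T ∧ InLocusShadow T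

/-- **CELL (L, D-perf) · DECIDED-MOD-PORT (g14's engine `DiscreteShadowLaw`, inherited — no new credit)**: in-locus,
some discrete shadow, perfect ground field. -/
def InLocusDiscretePerfectShadowTowersTerminate (n : ℕ) : Prop :=
  NoTowerPerfect n fun T => SingularClass T ∧ InLocusShadow T ∧ DiscreteShadow T

/-- **CELL (L, D-imp) · UNDECIDED · IDEA-NEEDED** (g14's (D-imp) SHRUNK to in-locus arcs; barrier
`SmoothVsRegularImperfectBase` bites): in-locus, some discrete shadow, imperfect ground field. -/
def InLocusDiscreteImperfectShadowTowersTerminate (n : ℕ) : Prop :=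
  NoTowerImperfect n fun T => SingularClass T ∧ InLocusShadow T ∧ DiscreteShadow T

/-- **CELL (L, Z) · UNDECIDED · IDEA-NEEDED (d = 4) · ATTACKABLE (d = 3: marking descent, docstring (L3)) ·
INSTRUMENTABLE**: in-locus, no discrete shadow (all dominating valuations dense, creeping — g14 (Z1)–(Z3)). -/
def InLocusDenseShadowTowersTerminate (n : ℕ) : Prop :=
  NoTower n fun T => SingularClass T ∧ InLocusShadow T ∧ ¬ DiscreteShadow T

end Summit.ResolutionOfSingularities.ResolutionOfSingularities.Theorems.HugValuationCut
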